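import Summits.NavierStokesRegularity.FluidComputer.ClayBlowupRows
import Summits.NavierStokesRegularity.FluidComputer.SelfSimilarForceVanishingNS
import Summits.NavierStokesRegularity.FluidComputer.DesignedBlowupNotSelfSimilar
import HarnessLib

/-!
# NO Clay blow-up is Leray self-similar near its lifespan (row R7 of the compatibility list, `γ = ½`,
# BY NAME on the types, no named fact)

Cell `ns-blowup`, seat `ns-blowup-ecbridge-2` (g5; the E–C endpoint theory seat). LABEL: E–C typing
(KERNEL — no named fact). WHAT THIS IS NOT: not Navier–Stokes evidence — a necessary condition on the
TYPES `ClayBlowup` / `DesignedBlowup` (no inhabitant is claimed anywhere): exact backward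
self-similarity of the velocity–pressure PAIR near the blow-up time (Leray 1934, (3.11)–(3.12)) is
excluded. Companion memo: `run/shared/lean/pub/ns-blowup/ecbridge2/ECBRIDGE-2-MEMO-4.md` §2 (R7).

## Content

Seat g0 proved the EXACT-ANSATZ wall in free-standing form
(`SelfSimilarForceVanishing.lerayBackward_forced_profile_eq_zero`: Leray's backward ansatz solving the
FORCED system on `(−∞, 0) × ℝ³` with a force continuous at the vertex has `U = 0` if `U ∈ L^q`,
`3 ≤ q < ∞` — Nečas–Růžička–Šverák / Tsai, both tree theorems). MEMO-3 left the by-name version open: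
«`u ≡ 0` near `T⁻` contradicts maximality only through forced local well-posedness». F2 is now a
theorem and the `L^∞` criterion `ClayBlowup.velocity_unbounded` is kernel, so:

* `ClayBlowup.isLerayProfile_of_eq_lerayBackward` — if the pair of a Clay blow-up (`ν > 0`)
  coincides on `(t₁, T) × ℝ³`, `0 ≤ t₁ < T`, with Leray's backward ansatz built on smooth profiles
  `(U, P)` (rate `a > 0`, blow-up time `T`), then `(U, P)` solves Leray's UNFORCED profile system
  (the ansatz extended to `(−∞, T)` with its own residual as force is a classical solution whose force
  equals the Clay force near the vertex, hence is continuous there; g0's lemma after time translation);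
* `ClayBlowup.memLp_three_profile_of_eq_lerayBackward` — and `U ∈ L³` AUTOMATICALLY: the slice
  `u(t*)` has finite energy (`U ∈ L²` by Haar change of variables) and is bounded (`U ∈ L^∞`);
* **`ClayBlowup.false_of_eq_lerayBackward`** — hence `U = 0` (NRŠ 1996 = tree theorem
  `necas_ruzicka_sverak_holds`), so `u ≡ 0` on `(t₁, T)`, so `u` is bounded on `[0, T)`,
  contradicting `velocity_unbounded`: NO CLAY BLOW-UP IS LERAY SELF-SIMILAR NEAR ITS LIFESPAN, for
  ANY smooth profile pair and any rate; **`DesignedBlowup.false_of_eq_lerayBackward`** — the same on the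
  strong type. Together with g4's collapse obstruction (`γ ≠ ½`, any pressure) the exact collapse
  ansatz `(T−t)^{γ−1} U(x/(T−t)^γ)` is never an E–C design for ANY `γ` (at `γ = ½`: as a pair).

References: J. Leray, Acta Math. 63 (1934), (3.11)–(3.12) [cite: Leray1934, (3.11)]; J. Nečas,
M. Růžička, V. Šverák, Acta Math. 176 (1996), Thm. 1 [cite: NecasRuzickaSverak1996, Thm 1 (p. 291)];
T.-P. Tsai, ARMA 143 (1998), Thm. 1 [cite: Tsai1998, Thm 1]; C. L. Fefferman, Clay problem
description, (C) [cite: FeffermanClay2006, (C)].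
-/

noncomputable section

namespace Summit.NavierStokesRegularity.FluidComputer

open Set MeasureTheory Filter Topology Function Laplacian
open scoped ENNReal ContDiff NNReal
open Literature.Analysis.FluidPDE
open Summit.NavierStokesRegularity.NavierStokesRegularity

/-! ## §1 Plumbing for Leray's backward ansatz -/

section Ansatz

variable {a T : ℝ} {U : EuclideanSpace ℝ (Fin 3) → EuclideanSpace ℝ (Fin 3)}
  {P : EuclideanSpace ℝ (Fin 3) → ℝ}

/-- Time translation of the velocity ansatz: blow-up time `T` at time `s + T` is blow-up time `0` at
time `s`. [folklore] -/
theorem lerayBackward_add_blowupTime (a T : ℝ) (U : EuclideanSpace ℝ (Fin 3) → EuclideanSpace ℝ (Fin 3))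
    (s : ℝ) : lerayBackward a T U (s + T) = lerayBackward a 0 U s := by
  funext x
  simp only [lerayBackward, show T - (s + T) = 0 - s by ring]

/-- Time translation of the pressure ansatz. [folklore] -/
theorem lerayBackwardPressure_add_blowupTime (a T : ℝ) (P : EuclideanSpace ℝ (Fin 3) → ℝ) (s : ℝ) :
    lerayBackwardPressure a T P (s + T) = lerayBackwardPressure a 0 P s := by
  funext x
  simp only [lerayBackwardPressure, show T - (s + T) = 0 - s by ring]

/-- The ansatz built on the zero profile vanishes. [folklore] -/
theorem lerayBackward_zero_profile (a T t : ℝ) :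
    lerayBackward a T (0 : EuclideanSpace ℝ (Fin 3) → EuclideanSpace ℝ (Fin 3)) t = 0 := by
  funext x
  simp [lerayBackward]

/-- A divergence-free slice of the ansatz before the blow-up time has a divergence-free profile
(`div u(t)(x) = λ² div U(λx)`, `λ > 0`, `x = λ⁻¹ y`). [folklore] -/
theorem isDivFree_profile_of_lerayBackward (ha : 0 < a) {t : ℝ} (ht : t < T)
    (hdiv : VectorCalculus.IsDivFree (lerayBackward a T U t)) : VectorCalculus.IsDivFree U := by
  intro y
  set L : ℝ := (Real.sqrt (2 * a * (T - t)))⁻¹ with hL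
  have hL0 : 0 < L := lerayScale_pos ha ht
  have h := hdiv (L⁻¹ • y)
  rw [divergence_lerayBackward, ← hL, smul_smul, mul_inv_cancel₀ hL0.ne', one_smul] at h
  exact (mul_eq_zero.1 h).resolve_left (pow_ne_zero 2 hL0.ne')

/-- **The ansatz pair, extended to `(−∞, T)`, is a classical solution with SOME force that equals a
given force wherever the pair solves the system with it.** Precisely: for smooth profiles with
`div U = 0`, `a > 0`, and a force `f` such that the ansatz pair satisfies the momentum equation with
`f` (two-sided time derivative) at every `(t, x)` with `t₁ < t < T`, the pair is a classical solution
on `(−∞, T)` with the force `F = f` for `t > t₁` and `F =` its own residual for `t ≤ t₁`. [folklore] -/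
theorem isClassicalNSSolutionOn_lerayBackward_extend {ν : ℝ} (ha : 0 < a) (hU : ContDiff ℝ ∞ U)
    (hP : ContDiff ℝ ∞ P) (hdivU : VectorCalculus.IsDivFree U)
    {f : ℝ → EuclideanSpace ℝ (Fin 3) → EuclideanSpace ℝ (Fin 3)} {t₁ : ℝ}
    (hmom : ∀ t ∈ Ioo t₁ T, ∀ x,
      timeDeriv (lerayBackward a T U) t x +
          convect (lerayBackward a T U t) (lerayBackward a T U t) x =
        ν • (Δ (lerayBackward a T U t)) x - gradient (lerayBackwardPressure a T P t) x + f t x) :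
    IsClassicalNSSolutionOn (Iio T) ν
      (fun t x => if t₁ < t then f t x else
        timeDeriv (lerayBackward a T U) t x +
            convect (lerayBackward a T U t) (lerayBackward a T U t) x -
          ν • (Δ (lerayBackward a T U t)) x + gradient (lerayBackwardPressure a T P t) x)
      (lerayBackward a T U) (lerayBackwardPressure a T P) := by
  have hsu : IsSmoothSpaceTimeOn (Iio T) (lerayBackward a T U) :=
    contDiffOn_uncurry_lerayBackward ha hU T
  have hsp : IsSmoothSpaceTimeOn (Iio T) (lerayBackwardPressure a T P) := by
    change ContDiffOn ℝ ∞ (uncurry (lerayBackwardPressure a T P)) (Iio T ×ˢ univ)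
    refine (contDiffOn_uncurry_lerayBackwardPressure_sub ha hP T 0).congr ?_
    rintro ⟨t, x⟩ hz
    have ht : t < T := hz.1
    simp only [uncurry_apply_pair, lerayBackwardPressure_eq_of_lt ha ht P]
  refine ⟨hsu, hsp, fun t ht x => ?_, fun t _ => isDivFree_lerayBackward hdivU a T t⟩
  have hint : t ∈ interior (Iio T) := by rw [interior_Iio]; exact ht
  rw [timeDerivWithin_of_mem_interior hint x]
  by_cases h : t₁ < t
  · rw [if_pos h]
    exact hmom t ⟨h, ht⟩ x
  · rw [if_neg h]
    abel

end Ansatz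

namespace ClayBlowup

variable {ν : ℝ} (X : ClayBlowup ν) {a t₁ : ℝ}
  {U : EuclideanSpace ℝ (Fin 3) → EuclideanSpace ℝ (Fin 3)} {P : EuclideanSpace ℝ (Fin 3) → ℝ}

/-! ## §2 The profile system and the integrability of the profile -/

/-- **A Clay blow-up that is Leray self-similar near its lifespan has a profile solving Leray's
UNFORCED profile system, and its force VANISHES near the lifespan.** (`ν` arbitrary here; `a > 0`,
`0 ≤ t₁ < T`, smooth profiles.) The ansatz pair extended to `(−∞, T)`
(`isClassicalNSSolutionOn_lerayBackward_extend`) carries the Clay force for `t > t₁`, which is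
continuous at the vertex `(T, 0)`; after translating the blow-up time to `0`, seat g0's
`isLerayProfile_of_forced_lerayBackward` applies. [cite: Leray1934, (3.11)]
[cite: NecasRuzickaSverak1996, (1.1)-(1.5)] -/
theorem isLerayProfile_of_eq_lerayBackward (ha : 0 < a) (hU : ContDiff ℝ ∞ U) (hP : ContDiff ℝ ∞ P)
    (ht₁0 : 0 ≤ t₁) (ht₁ : t₁ < X.T)
    (hu : ∀ t ∈ Ioo t₁ X.T, X.u t = lerayBackward a X.T U t)
    (hp : ∀ t ∈ Ioo t₁ X.T, X.p t = lerayBackwardPressure a X.T P t) :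
    IsLerayProfile ν a U P ∧ ∀ t ∈ Ioo t₁ X.T, ∀ x, X.f t x = 0 := by
  have hT := X.T_pos
  -- the profile is divergence free (read off one slice)
  obtain ⟨tm, htm1, htmT⟩ : ∃ tm, t₁ < tm ∧ tm < X.T := exists_between ht₁
  have hdivU : VectorCalculus.IsDivFree U := by
    have h := X.classical.divFree tm ⟨ht₁0.trans htm1.le, htmT⟩
    rw [hu tm ⟨htm1, htmT⟩] at h
    exact isDivFree_profile_of_lerayBackward ha htmT h
  -- the momentum equation of the blow-up, rewritten on the ansatz pair, on `(t₁, T)`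
  have hmom : ∀ t ∈ Ioo t₁ X.T, ∀ x,
      timeDeriv (lerayBackward a X.T U) t x +
          convect (lerayBackward a X.T U t) (lerayBackward a X.T U t) x =
        ν • (Δ (lerayBackward a X.T U t)) x - gradient (lerayBackwardPressure a X.T P t) x +
          X.f t x := by
    intro t ht x
    have hm := X.classical.momentum t ⟨ht₁0.trans ht.1.le, ht.2⟩ x
    rw [timeDerivWithin_Ico_eq_timeDeriv_of_eqOn ht₁0 ht (fun s hs y => by rw [hu s hs]) x,
      hu t ht, hp t ht] at hm
    exact hm
  have hsol := isClassicalNSSolutionOn_lerayBackward_extend (ν := ν) ha hU hP hdivU hmom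
  -- translate the blow-up time to `0`
  set F : ℝ → EuclideanSpace ℝ (Fin 3) → EuclideanSpace ℝ (Fin 3) := fun t x =>
    if t₁ < t then X.f t x else
      timeDeriv (lerayBackward a X.T U) t x +
          convect (lerayBackward a X.T U t) (lerayBackward a X.T U t) x -
        ν • (Δ (lerayBackward a X.T U t)) x + gradient (lerayBackwardPressure a X.T P t) x with hF
  have hshift := hsol.comp_add_right X.T
  have hSet : ((fun s : ℝ => s + X.T) ⁻¹' Iio X.T) = Iio 0 := by
    ext s; simp only [mem_preimage, mem_Iio]; constructor <;> intro h <;> linarith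
  have hu0 : (fun s => lerayBackward a X.T U (s + X.T)) = lerayBackward a 0 U := by
    funext s; exact lerayBackward_add_blowupTime a X.T U s
  have hp0 : (fun s => lerayBackwardPressure a X.T P (s + X.T)) = lerayBackwardPressure a 0 P := by
    funext s; exact lerayBackwardPressure_add_blowupTime a X.T P s
  rw [hSet, hu0, hp0] at hshift
  -- the translated force is the Clay force near the vertex, hence continuous there
  have hcont : ContinuousAt (uncurry fun s => F (s + X.T)) ((0 : ℝ), (0 : EuclideanSpace ℝ (Fin 3))) := by
    have hfc : ContinuousAt (uncurry X.f) (X.T, (0 : EuclideanSpace ℝ (Fin 3))) := by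
      have hmem : (Ici (0 : ℝ) ×ˢ (univ : Set (EuclideanSpace ℝ (Fin 3)))) ∈ 𝓝 (X.T, (0 : _)) :=
        prod_mem_nhds (Ici_mem_nhds hT) univ_mem
      exact (X.force_smooth.continuousOn.continuousWithinAt
        (mk_mem_prod (mem_Ici.2 hT.le) (mem_univ _))).continuousAt hmem
    have hshiftc : ContinuousAt (fun z : ℝ × EuclideanSpace ℝ (Fin 3) => (z.1 + X.T, z.2))
        ((0 : ℝ), (0 : EuclideanSpace ℝ (Fin 3))) :=
      ((continuous_fst.add continuous_const).prodMk continuous_snd).continuousAt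
    have hcomp : ContinuousAt (uncurry X.f ∘ fun z : ℝ × EuclideanSpace ℝ (Fin 3) => (z.1 + X.T, z.2))
        ((0 : ℝ), (0 : EuclideanSpace ℝ (Fin 3))) :=
      ContinuousAt.comp_of_eq hfc hshiftc (by simp)
    refine hcomp.congr ?_
    have hnhd : {z : ℝ × EuclideanSpace ℝ (Fin 3) | t₁ - X.T < z.1} ∈ 𝓝 ((0 : ℝ), (0 : _)) :=
      (isOpen_lt continuous_const continuous_fst).mem_nhds (by simp only [mem_setOf_eq]; linarith)
    filter_upwards [hnhd] with z hz
    have hz2 : t₁ - X.T < z.1 := hz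
    have hz' : t₁ < z.1 + X.T := by linarith
    show X.f (z.1 + X.T) z.2 = F (z.1 + X.T) z.2
    exact (if_pos hz').symm
  have key := SelfSimilarForceVanishing.isLerayProfile_of_forced_lerayBackward ha hU hP hshift hcont
  refine ⟨key.2, fun t ht x => ?_⟩
  have h0 : F (t - X.T + X.T) x = 0 := key.1 (t - X.T) (by linarith [ht.2]) x
  rw [sub_add_cancel] at h0
  have h1 : F t x = X.f t x := if_pos ht.1
  rw [h1] at h0
  exact h0

/-- **The profile of a Leray self-similar Clay blow-up is automatically in `L³`** (`ν > 0`): the slice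
`u(t*) = λ U(λ ·)`, `t₁ < t* < T`, has finite energy (so `U ∈ L²`, Haar change of variables) and is
bounded (so `U ∈ L^∞`), and `L² ∩ L^∞ ⊂ L³`. [cite: NecasRuzickaSverak1996, Thm 1 (p. 291)] -/
theorem memLp_three_profile_of_eq_lerayBackward (hν : 0 < ν) (ha : 0 < a) (hU : ContDiff ℝ ∞ U)
    (ht₁0 : 0 ≤ t₁) (ht₁ : t₁ < X.T) (hu : ∀ t ∈ Ioo t₁ X.T, X.u t = lerayBackward a X.T U t) :
    MemLp U 3 volume := by
  obtain ⟨tm, htm1, htmT⟩ : ∃ tm, t₁ < tm ∧ tm < X.T := exists_between ht₁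
  have htm0 : 0 < tm := ht₁0.trans_lt htm1
  set L : ℝ := (Real.sqrt (2 * a * (X.T - tm)))⁻¹ with hL
  have hL0 : 0 < L := lerayScale_pos ha htmT
  have hslice : ∀ x, X.u tm x = L • U (L • x) := fun x => by
    rw [hu tm ⟨htm1, htmT⟩]; rfl
  -- `U ∈ L²`
  have hE2 : MemLp (X.u tm) 2 volume := by
    obtain ⟨C₀, -, -, -, hC₀, -, -⟩ :=
      PalasekTowerClayBridge.ForcedContinuation.exists_force_slice_bounds X.force_smooth X.force_decay
    exact ((X.classical_Icc htm0 htmT).isLerayHopfOn_of_finiteEnergy_forced_L2 hν htm0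
      (Cf := C₀) ENNReal.coe_ne_top (fun t ht => hC₀ t ht.1) (X.energy tm htmT)).1.memLp tm
      ⟨htm0.le, le_rfl⟩
  have hU2 : MemLp U 2 volume :=
    DesignedBlowup.memLp_two_of_eq_smul_comp_smul hL0.ne' hL0.ne' hU.continuous hslice hE2
  -- `U` is bounded
  obtain ⟨B, hB⟩ := X.exists_norm_le hν htmT
  have hUB : ∀ y, ‖U y‖ ≤ L⁻¹ * B := fun y => by
    have h := hB tm ⟨htm0.le, le_rfl⟩ (L⁻¹ • y)
    rw [hslice, smul_smul, mul_inv_cancel₀ hL0.ne', one_smul, norm_smul, Real.norm_of_nonneg hL0.le]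
      at h
    rw [le_inv_mul_iff₀ hL0]
    exact h
  have hM0 : 0 ≤ L⁻¹ * B := le_trans (norm_nonneg _) (hUB 0)
  -- `L² ∩ L^∞ ⊂ L³`
  have h2 : ∫⁻ y, ‖U y‖ₑ ^ 2 < ⊤ := by
    have h := hU2.2
    rw [eLpNorm_lt_top_iff_lintegral_rpow_enorm_lt_top two_ne_zero ENNReal.ofNat_ne_top] at h
    simpa [ENNReal.toReal_ofNat] using h
  refine ⟨hU.continuous.aestronglyMeasurable, ?_⟩
  rw [eLpNorm_lt_top_iff_lintegral_rpow_enorm_lt_top (by norm_num) (by simp)]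
  have h3 : ∫⁻ y, ‖U y‖ₑ ^ (3 : ℝ≥0∞).toReal = ∫⁻ y, ‖U y‖ₑ ^ 3 := by
    refine lintegral_congr fun y => ?_
    rw [ENNReal.toReal_ofNat, show (3 : ℝ) = ((3 : ℕ) : ℝ) by norm_num, ENNReal.rpow_natCast]
  rw [h3]
  calc ∫⁻ y, ‖U y‖ₑ ^ 3 ≤ ∫⁻ y, ENNReal.ofReal (L⁻¹ * B) * ‖U y‖ₑ ^ 2 := by
        refine lintegral_mono fun y => ?_
        rw [pow_succ, mul_comm]
        gcongr
        rw [← ofReal_norm]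
        exact ENNReal.ofReal_le_ofReal (hUB y)
    _ = ENNReal.ofReal (L⁻¹ * B) * ∫⁻ y, ‖U y‖ₑ ^ 2 := lintegral_const_mul' _ _ ENNReal.ofReal_ne_top
    _ < ⊤ := ENNReal.mul_lt_top ENNReal.ofReal_lt_top h2

/-! ## §3 The exclusion -/

/-- **NO CLAY BLOW-UP IS LERAY SELF-SIMILAR NEAR ITS LIFESPAN** (`ν > 0`; no named fact): if the
velocity–pressure pair coincides on `(t₁, T) × ℝ³`, `0 ≤ t₁ < T`, with Leray's backward ansatz
`u = (2a(T−t))^{-1/2} U(x/√(2a(T−t)))`, `p = (2a(T−t))^{-1} P(x/√(2a(T−t)))` for smooth profiles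
`(U, P)` and a rate `a > 0`, we reach a contradiction: the profile solves Leray's system
(`isLerayProfile_of_eq_lerayBackward`) and lies in `L³` (`memLp_three_profile_of_eq_lerayBackward`),
so `U = 0` by Nečas–Růžička–Šverák (tree theorem `necas_ruzicka_sverak_holds`), so `u ≡ 0` on
`(t₁, T)` and `u` is bounded on `[0, T)` — against `velocity_unbounded`.
[cite: NecasRuzickaSverak1996, Thm 1 (p. 291)] [cite: Leray1934, (3.11)] -/
theorem false_of_eq_lerayBackward (hν : 0 < ν) (ha : 0 < a) (hU : ContDiff ℝ ∞ U) (hP : ContDiff ℝ ∞ P)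
    (ht₁0 : 0 ≤ t₁) (ht₁ : t₁ < X.T)
    (hu : ∀ t ∈ Ioo t₁ X.T, X.u t = lerayBackward a X.T U t)
    (hp : ∀ t ∈ Ioo t₁ X.T, X.p t = lerayBackwardPressure a X.T P t) : False := by
  have hprof := (X.isLerayProfile_of_eq_lerayBackward ha hU hP ht₁0 ht₁ hu hp).1
  have hU3 := X.memLp_three_profile_of_eq_lerayBackward hν ha hU ht₁0 ht₁ hu
  have hU0 : U = 0 := necas_ruzicka_sverak_holds hν ha hprof hU3
  -- the blow-up vanishes on `(t₁, T)`, hence is bounded on `[0, T)`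
  obtain ⟨tm, htm1, htmT⟩ : ∃ tm, t₁ < tm ∧ tm < X.T := exists_between ht₁
  obtain ⟨B, hB⟩ := X.exists_norm_le hν htmT
  refine X.velocity_unbounded hν ⟨max B 0, fun t ht x => ?_⟩
  rcases le_or_gt t tm with htle | htgt
  · exact (hB t ⟨ht.1, htle⟩ x).trans (le_max_left _ _)
  · have h0 : X.u t = 0 := by
      rw [hu t ⟨htm1.trans htgt, ht.2⟩, hU0, lerayBackward_zero_profile]
    rw [h0]
    simp

/-- **The force of a Leray self-similar stretch would have to vanish near the lifespan** (recorded
for designs: an E–C design that is Leray self-similar on `(t₁, T)` is UNFORCED there — before it is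
excluded altogether by `false_of_eq_lerayBackward`). [cite: Leray1934, (3.11)] -/
theorem force_eq_zero_of_eq_lerayBackward (ha : 0 < a) (hU : ContDiff ℝ ∞ U) (hP : ContDiff ℝ ∞ P)
    (ht₁0 : 0 ≤ t₁) (ht₁ : t₁ < X.T)
    (hu : ∀ t ∈ Ioo t₁ X.T, X.u t = lerayBackward a X.T U t)
    (hp : ∀ t ∈ Ioo t₁ X.T, X.p t = lerayBackwardPressure a X.T P t) :
    ∀ t ∈ Ioo t₁ X.T, ∀ x, X.f t x = 0 :=
  (X.isLerayProfile_of_eq_lerayBackward ha hU hP ht₁0 ht₁ hu hp).2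

end ClayBlowup

/-- **NO DESIGNED FORCED BLOW-UP IS LERAY SELF-SIMILAR NEAR ITS BLOW-UP TIME** (`ν > 0`; no named
fact; the strong type via `toClayBlowup`). Row R7 (`γ = ½`) of the compatibility list, by name.
[cite: NecasRuzickaSverak1996, Thm 1 (p. 291)] [cite: FeffermanClay2006, (C)] -/
theorem DesignedBlowup.false_of_eq_lerayBackward {ν : ℝ} (D : DesignedBlowup ν) (hν : 0 < ν)
    {a t₁ : ℝ} (ha : 0 < a) {U : EuclideanSpace ℝ (Fin 3) → EuclideanSpace ℝ (Fin 3)}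
    {P : EuclideanSpace ℝ (Fin 3) → ℝ} (hU : ContDiff ℝ ∞ U) (hP : ContDiff ℝ ∞ P)
    (ht₁0 : 0 ≤ t₁) (ht₁ : t₁ < D.T)
    (hu : ∀ t ∈ Ioo t₁ D.T, D.u t = lerayBackward a D.T U t)
    (hp : ∀ t ∈ Ioo t₁ D.T, D.p t = lerayBackwardPressure a D.T P t) : False :=
  D.toClayBlowup.false_of_eq_lerayBackward hν ha hU hP ht₁0 ht₁ hu hp

end Summit.NavierStokesRegularity.FluidComputer

end
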